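import Literature.Geometry.DiscreteGeometry.SphericalCodeHullVertexLink
import HarnessLib

/-!
# The fan triangulation of the hull of a spherical code as an ORIENTED ROTATION SYSTEM —
# brick (G2) «the ambient planar map» of `phase2/LEAN-FACES-DESIGN.md` §5.3, part 1: darts,
# the edge involution, and the frame-free oriented vertex rotation

HONEST FRAMING. Part of the venture `Summits/Ventures/Crystal3D` (cell `pub-crystal3d`, phase 2;
seat p3), generic and configuration-free: `X` is ANY finite set of unit vectors of `ℝ³` with
`0 ∈ interior (conv X)` (for the GAP census: typer-bulk-2's `dirSet c`, the thirteen directions,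
`Bulk/GapHullMap.lean`). Nothing here mentions GAP(1.26) or asserts anything about it. The
Literature (`KissingFanTriangleSets`, `SphericalCodeHullVertexWedge/VertexLink`) triangulates
`∂ conv X` by the fan triangles `fanTriSets X` (three-element vertex sets; every side in exactly
two triangles, `card_filter_fanTriSets_eq_two`; the wedge lemma `not_sameSide_of_fanNbr`). This
file turns that triangulation into the combinatorial object the Euler / planarity plan (G1)–(G3)
needs — a rotation system `(σ_H, α)` on darts — WITHOUT tangent frames or azimuths, so that the
orientation convention is the same at every vertex by construction:

* `hullDarts X` — ordered pairs `(y, a)` of distinct points in a common fan triangle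
  (`mk_mem_hullDarts_iff`: `a ∈ fanNbrs X y`); `Prod.swap` is the edge involution `α`
  (`swap_mem_hullDarts`), fixed-point-free (`fst_ne_snd_of_mem_hullDarts`);
* **`orient3_mul_orient3_neg`** — THE geometric input: the two fan triangles `{y, a, b₁}`,
  `{y, a, b₂}` on a dart `(y, a)` have `orient3 y a b₁ · orient3 y a b₂ < 0` (wedge lemma twice);
  hence `existsUnique_isPosThird`: exactly one third vertex `b` with `{y, a, b} ∈ fanTriSets X`
  and `orient3 y a b > 0` (counter-clockwise seen from outside — the convention of typer-bulk-2's
  `onextNbr`, `IsGapConfig.orient3_onextNbr_pos`);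
* `succV X y a` — that vertex; **`hullSucc X (y, a) = (y, succV X y a)`** — the oriented vertex
  rotation `σ_H`; `hullSucc_mem_hullDarts`, `hullSucc_injOn`, **`hullSucc_bijOn`** (a
  permutation of the darts), `hullSucc_eq_iff` (characterisation), and looplessness
  `iterate_hullSucc_ne_swap` (`α d` is never on the `σ_H`-orbit of `d`: `σ_H` fixes the tail).

Part 2 (`Bulk/HullRotSysFaces.lean`): the face permutation `σ_H ∘ α` has all orbits of length
`3`, in bijection with `fanTriSets X`; the counts `#darts = 6N − 12`, `#triangles = 2N − 4`,
`N` vertex orbits, one connected class (`χ = 2`).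
-/

noncomputable section

namespace Summit.Ventures.Crystal3D

namespace HullRotSys

open Literature.Geometry.DiscreteGeometry Finset

variable {X : Finset (EuclideanSpace ℝ (Fin 3))}

/-! ## Darts and the edge involution -/

/-- The **darts** of the fan triangulation of `conv X`: ordered pairs `(y, a)` of distinct
points of `X` lying in a common fan triangle. -/
def hullDarts (X : Finset (EuclideanSpace ℝ (Fin 3))) : Finset (EuclideanSpace ℝ
    (Fin 3) × EuclideanSpace ℝ (Fin 3)) :=
  (fanTriSets X).biUnion fun t => t.offDiag

/-- Membership in `hullDarts`. -/
theorem mem_hullDarts {p : EuclideanSpace ℝ (Fin 3) × EuclideanSpace ℝ (Fin 3)} :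
    p ∈ hullDarts X ↔ ∃ t ∈ fanTriSets X, p.1 ∈ t ∧ p.2 ∈ t ∧ p.1 ≠ p.2 := by
  simp only [hullDarts, mem_biUnion, mem_offDiag]

/-- `(y, a)` is a dart iff `a` is a fan neighbour of `y` (Literature `fanNbrs`). -/
theorem mk_mem_hullDarts_iff {y a : EuclideanSpace ℝ (Fin 3)} : (y, a) ∈ hullDarts X ↔ a
    ∈ fanNbrs X y := by
  rw [mem_hullDarts, mem_fanNbrs]
  exact ⟨fun ⟨t, ht, hy, ha, hne⟩ => ⟨t, ht, hy, ha, fun h => hne h.symm⟩,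
    fun ⟨t, ht, hy, ha, hne⟩ => ⟨t, ht, hy, ha, fun h => hne h.symm⟩⟩

/-- The two ends of a dart are distinct (the edge involution `Prod.swap` has no fixed dart). -/
theorem fst_ne_snd_of_mem_hullDarts {p : EuclideanSpace ℝ (Fin 3) × EuclideanSpace ℝ (Fin 3)} (hp
    : p ∈ hullDarts X) : p.1 ≠ p.2 := by
  obtain ⟨_, _, _, _, hne⟩ := mem_hullDarts.1 hp
  exact hne

/-- A dart reversed is a dart: `hullDarts X` is closed under the edge involution `Prod.swap`. -/
theorem swap_mem_hullDarts {p : EuclideanSpace ℝ (Fin 3) × EuclideanSpace ℝ (Fin 3)} (hp : p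
    ∈ hullDarts X) : p.swap ∈ hullDarts X := by
  obtain ⟨t, ht, h1, h2, hne⟩ := mem_hullDarts.1 hp
  exact mem_hullDarts.2 ⟨t, ht, h2, h1, hne.symm⟩

/-- A reversed dart differs from the dart. -/
theorem swap_ne_of_mem_hullDarts {p : EuclideanSpace ℝ (Fin 3) × EuclideanSpace ℝ (Fin 3)} (hp : p
    ∈ hullDarts X) : p.swap ≠ p := by
  intro h
  have h1 : p.2 = p.1 := by simpa using congrArg Prod.fst h
  exact fst_ne_snd_of_mem_hullDarts hp h1.symm

/-- The tail of a dart is a point of `X`. -/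
theorem fst_mem_of_mem_hullDarts (hX1 : ∀ y ∈ X, ‖y‖ = 1) {p : EuclideanSpace ℝ
    (Fin 3) × EuclideanSpace ℝ (Fin 3)} (hp : p ∈ hullDarts X) :
    p.1 ∈ X := by
  obtain ⟨t, ht, h1, _, _⟩ := mem_hullDarts.1 hp
  exact subset_of_mem_fanTriSets hX1 ht h1

/-- The head of a dart is a point of `X`. -/
theorem snd_mem_of_mem_hullDarts (hX1 : ∀ y ∈ X, ‖y‖ = 1) {p : EuclideanSpace ℝ
    (Fin 3) × EuclideanSpace ℝ (Fin 3)} (hp : p ∈ hullDarts X) :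
    p.2 ∈ X :=
  fst_mem_of_mem_hullDarts hX1 (swap_mem_hullDarts hp)

/-- A fan triangle through two distinct points `y, a` is `{y, a, b}` for a third vertex `b`. -/
theorem exists_eq_triple (hX1 : ∀ y ∈ X, ‖y‖ = 1) {t : Finset (EuclideanSpace ℝ (Fin 3))} (ht : t
    ∈ fanTriSets X)
    {y a : EuclideanSpace ℝ (Fin 3)} (hy : y ∈ t) (ha : a ∈ t) (hya : y ≠ a) :
    ∃ b : EuclideanSpace ℝ (Fin 3), t = {y, a, b} ∧ y ≠ b ∧ a ≠ b := by
  have h3 := card_eq_three_of_mem_fanTriSets hX1 ht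
  have hay : a ∈ t.erase y := mem_erase.2 ⟨fun h => hya h.symm, ha⟩
  have h1 : ((t.erase y).erase a).card = 1 := by
    rw [card_erase_of_mem hay, card_erase_of_mem hy, h3]
  obtain ⟨b, hb⟩ := card_eq_one.1 h1
  have hbmem : b ∈ (t.erase y).erase a := by rw [hb]; exact mem_singleton_self b
  simp only [mem_erase] at hbmem
  refine ⟨b, ?_, fun h => hbmem.2.1 h.symm, fun h => hbmem.1 h.symm⟩
  rw [← insert_erase hy, ← insert_erase hay, hb]

/-- Darts of a triangle: two distinct vertices of a fan triangle form a dart. -/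
theorem mk_mem_hullDarts {t : Finset (EuclideanSpace ℝ (Fin 3))} (ht : t ∈ fanTriSets X) {y a
    : EuclideanSpace ℝ (Fin 3)} (hy : y ∈ t)
    (ha : a ∈ t) (hya : y ≠ a) : (y, a) ∈ hullDarts X :=
  mem_hullDarts.2 ⟨t, ht, hy, ha, hya⟩

/-! ## The geometric input: opposite orientations of the two triangles on a dart -/

/-- A fan triangle `{y, a, b}` with pairwise distinct labels is non-degenerate:
`orient3 y a b ≠ 0` (its vertices are tight for one facet, Literature
`orient3_ne_zero_of_three_tight`). -/
theorem orient3_ne_zero_of_mem_fanTriSets (hX1 : ∀ y ∈ X, ‖y‖ = 1) {y a b : EuclideanSpace ℝ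
    (Fin 3)}
    (ht : ({y, a, b} : Finset (EuclideanSpace ℝ (Fin 3))) ∈ fanTriSets X) (hya : y ≠ a) (hyb
        : y ≠ b) (hab : a ≠ b) :
    orient3 y a b ≠ 0 := by
  obtain ⟨c, hc, hsub⟩ := exists_subset_tightSet_of_mem_fanTriSets hX1 ht
  exact orient3_ne_zero_of_three_tight hX1 hc (hsub (by simp)) (hsub (by simp)) (hsub (by simp))
    hya hyb hab

/-- **The two fan triangles on a dart are oppositely oriented.** If `{y, a, b₁}` and
`{y, a, b₂}` are fan triangles with `b₁ ≠ b₂` (all labels distinct), then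
`orient3 y a b₁ · orient3 y a b₂ < 0`. Proof: both determinants are nonzero; if they had the
same sign, the wedge lemma `not_sameSide_of_fanNbr` at the triangle `{y, a, b₁}` against the fan
neighbour `b₂` forces `orient3 y a b₁ · orient3 y b₂ b₁ < 0`, and at `{y, a, b₂}` against `b₁`
forces `orient3 y a b₂ · orient3 y b₁ b₂ < 0`; with `orient3 y b₁ b₂ = −orient3 y b₂ b₁` the two
products multiply to a negative square. -/
theorem orient3_mul_orient3_neg (hX1 : ∀ y ∈ X, ‖y‖ = 1) {y a b₁ b₂ : EuclideanSpace ℝ (Fin 3)}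
    (h₁ : ({y, a, b₁} : Finset (EuclideanSpace ℝ (Fin 3))) ∈ fanTriSets X) (h₂ : ({y, a, b₂}
        : Finset (EuclideanSpace ℝ (Fin 3))) ∈ fanTriSets X)
    (hya : y ≠ a) (hy₁ : y ≠ b₁) (ha₁ : a ≠ b₁) (hy₂ : y ≠ b₂) (ha₂ : a ≠ b₂) (h₁₂ : b₁ ≠ b₂) :
    orient3 y a b₁ * orient3 y a b₂ < 0 := by
  have O₁ := orient3_ne_zero_of_mem_fanTriSets hX1 h₁ hya hy₁ ha₁
  have O₂ := orient3_ne_zero_of_mem_fanTriSets hX1 h₂ hya hy₂ ha₂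
  by_contra hge
  rw [not_lt] at hge
  have hpos : 0 < orient3 y a b₁ * orient3 y a b₂ :=
    lt_of_le_of_ne hge (Ne.symm (mul_ne_zero O₁ O₂))
  have w₁ := not_sameSide_of_fanNbr hX1 h₁ h₂ rfl hya hy₁ ha₁ (by simp) (by simp) hy₂
    (Ne.symm ha₂) (Ne.symm h₁₂)
  have w₂ := not_sameSide_of_fanNbr hX1 h₂ h₁ rfl hya hy₂ ha₂ (by simp) (by simp) hy₁
    (Ne.symm ha₁) h₁₂
  have hz₁ : orient3 y a b₁ * orient3 y b₂ b₁ < 0 := by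
    by_contra h
    rw [not_lt] at h
    exact w₁ ⟨hpos.le, h, Or.inl hpos⟩
  have hpos' : 0 < orient3 y a b₂ * orient3 y a b₁ := by rw [mul_comm]; exact hpos
  have hz₂ : orient3 y a b₂ * orient3 y b₁ b₂ < 0 := by
    by_contra h
    rw [not_lt] at h
    exact w₂ ⟨hpos'.le, h, Or.inl hpos'⟩
  rw [orient3_swap_right y b₁ b₂] at hz₂
  nlinarith [mul_nonneg hpos.le (sq_nonneg (orient3 y b₂ b₁))]

/-! ## The positively oriented third vertex and the vertex rotation `σ_H` -/

/-- `b` is the **positively oriented third vertex** of the dart `(y, a)`: `{y, a, b}` is a fan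
triangle and `orient3 y a b > 0` (the triangle `y, a, b` is counter-clockwise seen from outside
the sphere — the orientation convention of typer-bulk-2's `onextNbr`). -/
def IsPosThird (X : Finset (EuclideanSpace ℝ (Fin 3))) (y a b : EuclideanSpace ℝ (Fin 3)) : Prop :=
  ({y, a, b} : Finset (EuclideanSpace ℝ (Fin 3))) ∈ fanTriSets X ∧ 0 < orient3 y a b

/-- A positively oriented triple has `y ≠ a`. -/
theorem IsPosThird.ne₁₂ {y a b : EuclideanSpace ℝ (Fin 3)} (h : IsPosThird X y a b) : y ≠ a := by
  rintro rfl; exact h.2.ne' (orient3_self_left y b)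

/-- A positively oriented triple has `y ≠ b`. -/
theorem IsPosThird.ne₁₃ {y a b : EuclideanSpace ℝ (Fin 3)} (h : IsPosThird X y a b) : y ≠ b := by
  rintro rfl; exact h.2.ne' (orient3_self_outer y a)

/-- A positively oriented triple has `a ≠ b`. -/
theorem IsPosThird.ne₂₃ {y a b : EuclideanSpace ℝ (Fin 3)} (h : IsPosThird X y a b) : a ≠ b := by
  rintro rfl; exact h.2.ne' (orient3_self_right y a)

/-- Cyclic invariance: `(y, a, b)` positively oriented ⇒ `(a, b, y)` positively oriented. -/
theorem IsPosThird.cyclic {y a b : EuclideanSpace ℝ (Fin 3)} (h : IsPosThird X y a b)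
    : IsPosThird X a b y := by
  refine ⟨?_, by rw [← orient3_cyclic]; exact h.2⟩
  have : ({a, b, y} : Finset (EuclideanSpace ℝ (Fin 3))) = {y, a, b} := by
    ext z; simp only [mem_insert, mem_singleton]; tauto
  rw [this]; exact h.1

/-- **The two fan triangles on a dart**: `{y, a, b₁}` and `{y, a, b₂}` with `b₁ ≠ b₂`, and
every fan triangle through `y, a` is one of them. -/
theorem exists_two_thirds (hX1 : ∀ y ∈ X, ‖y‖ = 1)
    (h0 : (0 : EuclideanSpace ℝ (Fin 3)) ∈ interior (convexHull ℝ (X : Set _))) {y a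
        : EuclideanSpace ℝ (Fin 3)} (hd : (y, a) ∈ hullDarts X) :
    ∃ b₁ b₂ : EuclideanSpace ℝ (Fin 3), b₁ ≠ b₂ ∧ ({y, a, b₁} : Finset (EuclideanSpace ℝ (Fin 3)))
        ∈ fanTriSets X ∧
      ({y, a, b₂} : Finset (EuclideanSpace ℝ (Fin 3))) ∈ fanTriSets X ∧ y ≠ b₁ ∧ a ≠ b₁ ∧ y ≠ b₂
          ∧ a ≠ b₂ ∧
      ∀ t ∈ fanTriSets X, y ∈ t → a ∈ t → t = {y, a, b₁} ∨ t = {y, a, b₂} := by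
  obtain ⟨t, ht, hyt, hat, hya⟩ := mem_hullDarts.1 hd
  simp only at hyt hat hya
  have hs : ({y, a} : Finset (EuclideanSpace ℝ (Fin 3))) ⊆ t
      := insert_subset_iff.2 ⟨hyt, singleton_subset_iff.2 hat⟩
  have h2 := card_filter_fanTriSets_eq_two hX1 h0 ht hs (card_pair hya)
  obtain ⟨t₁, t₂, hne, hS⟩ := card_eq_two.1 h2
  have hmem : ∀ t' ∈ fanTriSets X, y ∈ t' → a ∈ t' → t' = t₁ ∨ t' = t₂ := by
    intro t' ht' hy' ha'
    have : t' ∈ (fanTriSets X).filter (fun t'' => ({y, a} : Finset (EuclideanSpace ℝ (Fin 3)))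
        ⊆ t'') :=
      mem_filter.2 ⟨ht', insert_subset_iff.2 ⟨hy', singleton_subset_iff.2 ha'⟩⟩
    rw [hS, mem_insert, mem_singleton] at this
    exact this
  have ht₁ : t₁ ∈ (fanTriSets X).filter (fun t'' => ({y, a} : Finset (EuclideanSpace ℝ (Fin 3)))
      ⊆ t'') := by
    rw [hS]; exact mem_insert_self _ _
  have ht₂ : t₂ ∈ (fanTriSets X).filter (fun t'' => ({y, a} : Finset (EuclideanSpace ℝ (Fin 3)))
      ⊆ t'') := by
    rw [hS]; exact mem_insert_of_mem (mem_singleton_self _)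
  rw [mem_filter, insert_subset_iff, singleton_subset_iff] at ht₁ ht₂
  obtain ⟨b₁, rfl, hy₁, ha₁⟩ := exists_eq_triple hX1 ht₁.1 ht₁.2.1 ht₁.2.2 hya
  obtain ⟨b₂, rfl, hy₂, ha₂⟩ := exists_eq_triple hX1 ht₂.1 ht₂.2.1 ht₂.2.2 hya
  refine ⟨b₁, b₂, fun h => hne (by rw [h]), ht₁.1, ht₂.1, hy₁, ha₁, hy₂, ha₂, hmem⟩

/-- **Exactly one positively oriented third vertex on every dart.** -/
theorem existsUnique_isPosThird (hX1 : ∀ y ∈ X, ‖y‖ = 1)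
    (h0 : (0 : EuclideanSpace ℝ (Fin 3)) ∈ interior (convexHull ℝ (X : Set _))) {y a
        : EuclideanSpace ℝ (Fin 3)} (hd : (y, a) ∈ hullDarts X) :
    ∃! b : EuclideanSpace ℝ (Fin 3), IsPosThird X y a b := by
  have hya : y ≠ a := fst_ne_snd_of_mem_hullDarts hd
  obtain ⟨b₁, b₂, h₁₂, h₁, h₂, hy₁, ha₁, hy₂, ha₂, hall⟩ := exists_two_thirds hX1 h0 hd
  have hneg := orient3_mul_orient3_neg hX1 h₁ h₂ hya hy₁ ha₁ hy₂ ha₂ h₁₂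
  -- uniqueness among all candidates
  have huniq : ∀ b b' : EuclideanSpace ℝ (Fin 3), IsPosThird X y a b → IsPosThird X y a b' → b
      = b' := by
    intro b b' hb hb'
    by_contra hbb'
    have := orient3_mul_orient3_neg hX1 hb.1 hb'.1 hya hb.ne₁₃ hb.ne₂₃ hb'.ne₁₃ hb'.ne₂₃ hbb'
    nlinarith [mul_pos hb.2 hb'.2]
  rcases lt_or_gt_of_ne (orient3_ne_zero_of_mem_fanTriSets hX1 h₁ hya hy₁ ha₁) with hlt | hgt
  · have hb₂ : 0 < orient3 y a b₂ := by nlinarith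
    exact ⟨b₂, ⟨h₂, hb₂⟩, fun b hb => huniq b b₂ hb ⟨h₂, hb₂⟩⟩
  · exact ⟨b₁, ⟨h₁, hgt⟩, fun b hb => huniq b b₁ hb ⟨h₁, hgt⟩⟩

open Classical in
/-- **The oriented successor vertex**: for a dart `(y, a)`, the positively oriented third
vertex of `(y, a)` (junk value `a` off the darts). -/
def succV (X : Finset (EuclideanSpace ℝ (Fin 3))) (y a : EuclideanSpace ℝ (Fin 3))
    : EuclideanSpace ℝ (Fin 3) :=
  if h : ∃ b, IsPosThird X y a b then h.choose else a

/-- The successor vertex of a dart is positively oriented. -/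
theorem isPosThird_succV (hX1 : ∀ y ∈ X, ‖y‖ = 1)
    (h0 : (0 : EuclideanSpace ℝ (Fin 3)) ∈ interior (convexHull ℝ (X : Set _))) {y a
        : EuclideanSpace ℝ (Fin 3)} (hd : (y, a) ∈ hullDarts X) :
    IsPosThird X y a (succV X y a) := by
  have hex : ∃ b, IsPosThird X y a b := (existsUnique_isPosThird hX1 h0 hd).exists
  unfold succV
  rw [dif_pos hex]
  exact hex.choose_spec

/-- Characterisation: the successor vertex is THE positively oriented third vertex. -/
theorem succV_eq_iff (hX1 : ∀ y ∈ X, ‖y‖ = 1)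
    (h0 : (0 : EuclideanSpace ℝ (Fin 3)) ∈ interior (convexHull ℝ (X : Set _))) {y a b
        : EuclideanSpace ℝ (Fin 3)} (hd : (y, a) ∈ hullDarts X) :
    succV X y a = b ↔ IsPosThird X y a b := by
  constructor
  · rintro rfl; exact isPosThird_succV hX1 h0 hd
  · exact fun hb => (existsUnique_isPosThird hX1 h0 hd).unique (isPosThird_succV hX1 h0 hd) hb

/-- **The oriented vertex rotation `σ_H`**: `(y, a) ↦ (y, succV X y a)` — turn at the tail `y`
to the next fan neighbour counter-clockwise (seen from outside). -/
def hullSucc (X : Finset (EuclideanSpace ℝ (Fin 3))) (p : EuclideanSpace ℝ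
    (Fin 3) × EuclideanSpace ℝ (Fin 3)) : EuclideanSpace ℝ (Fin 3) × EuclideanSpace ℝ (Fin 3) :=
    (p.1, succV X p.1 p.2)

/-- `σ_H` fixes the tail. -/
@[simp] theorem hullSucc_fst (p : EuclideanSpace ℝ (Fin 3) × EuclideanSpace ℝ (Fin 3)) :
    (hullSucc X p).1 = p.1 := rfl

/-- `σ_H` on a pair. -/
theorem hullSucc_mk (y a : EuclideanSpace ℝ (Fin 3)) : hullSucc X (y, a) = (y, succV X y a) := rfl

/-- `σ_H` maps darts to darts. -/
theorem hullSucc_mem_hullDarts (hX1 : ∀ y ∈ X, ‖y‖ = 1)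
    (h0 : (0 : EuclideanSpace ℝ (Fin 3)) ∈ interior (convexHull ℝ (X : Set _))) {p
        : EuclideanSpace ℝ (Fin 3) × EuclideanSpace ℝ (Fin 3)} (hp : p ∈ hullDarts X) :
    hullSucc X p ∈ hullDarts X := by
  obtain ⟨y, a⟩ := p
  have h := isPosThird_succV hX1 h0 hp
  exact mk_mem_hullDarts h.1 (by simp) (by simp) h.ne₁₃

/-- Characterisation of `σ_H` on darts: `σ_H (y, a) = (y, b)` iff `{y, a, b}` is a fan triangle
with `orient3 y a b > 0`. -/
theorem hullSucc_eq_iff (hX1 : ∀ y ∈ X, ‖y‖ = 1)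
    (h0 : (0 : EuclideanSpace ℝ (Fin 3)) ∈ interior (convexHull ℝ (X : Set _))) {y a b
        : EuclideanSpace ℝ (Fin 3)} (hd : (y, a) ∈ hullDarts X) :
    hullSucc X (y, a) = (y, b) ↔ IsPosThird X y a b := by
  rw [hullSucc_mk, Prod.mk.injEq, ← succV_eq_iff hX1 h0 hd]
  exact ⟨fun h => h.2, fun h => ⟨rfl, h⟩⟩

/-- The predecessor is determined: if `σ_H (y, a) = σ_H (y, a')` on darts then `a = a'` (both
`a` and `a'` are the NEGATIVELY oriented third vertex of the dart `(y, b)`). -/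
theorem hullSucc_injOn (hX1 : ∀ y ∈ X, ‖y‖ = 1)
    (h0 : (0 : EuclideanSpace ℝ (Fin 3)) ∈ interior (convexHull ℝ (X : Set _))) :
    Set.InjOn (hullSucc X) (hullDarts X : Set _) := by
  rintro ⟨y, a⟩ hp ⟨y', a'⟩ hp' h
  rw [Finset.mem_coe] at hp hp'
  have hy : y = y' := congrArg Prod.fst h
  subst hy
  have hb := isPosThird_succV hX1 h0 hp
  have hb' := isPosThird_succV hX1 h0 hp'
  have hs : succV X y a' = succV X y a := (congrArg Prod.snd h).symm
  rw [hs] at hb'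
  set b := succV X y a
  -- `{y, b, a}` and `{y, b, a'}` are fan triangles with `orient3 y b a < 0`, `orient3 y b a' < 0`
  by_contra hne
  have hne' : a ≠ a' := fun h => hne (by rw [h])
  have e : ∀ x : EuclideanSpace ℝ (Fin 3), ({y, b, x} : Finset (EuclideanSpace ℝ (Fin 3))) =
      {y, x, b} := fun x => by
    ext z; simp only [mem_insert, mem_singleton]; tauto
  have t₁ : ({y, b, a} : Finset (EuclideanSpace ℝ (Fin 3))) ∈ fanTriSets X := by rw [e]; exact hb.1
  have t₂ : ({y, b, a'} : Finset (EuclideanSpace ℝ (Fin 3))) ∈ fanTriSets X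
      := by rw [e]; exact hb'.1
  have hneg := orient3_mul_orient3_neg hX1 t₁ t₂ hb.ne₁₃ hb.ne₁₂ (Ne.symm hb.ne₂₃) hb'.ne₁₂
    (Ne.symm hb'.ne₂₃) hne'
  rw [orient3_swap_right y b a, orient3_swap_right y b a'] at hneg
  nlinarith [mul_pos hb.2 hb'.2]

/-- **`σ_H` is a permutation of the darts.** -/
theorem hullSucc_bijOn (hX1 : ∀ y ∈ X, ‖y‖ = 1)
    (h0 : (0 : EuclideanSpace ℝ (Fin 3)) ∈ interior (convexHull ℝ (X : Set _))) :
    Set.BijOn (hullSucc X) (hullDarts X : Set _) (hullDarts X : Set _) := by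
  have hmaps : Set.MapsTo (hullSucc X) (hullDarts X : Set _) (hullDarts X) :=
    fun p hp => Finset.mem_coe.2 (hullSucc_mem_hullDarts hX1 h0 (Finset.mem_coe.1 hp))
  exact ⟨hmaps, hullSucc_injOn hX1 h0,
    Finset.surjOn_of_injOn_of_card_le _ hmaps (hullSucc_injOn hX1 h0) le_rfl⟩

/-- Iterates of `σ_H` fix the tail. -/
theorem iterate_hullSucc_fst (k : ℕ) (p : EuclideanSpace ℝ (Fin 3) × EuclideanSpace ℝ (Fin 3)) :
    ((hullSucc X)^[k] p).1 = p.1 := by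
  induction k with
  | zero => rfl
  | succ k ih => rw [Function.iterate_succ_apply', hullSucc_fst, ih]

/-- **Loopless**: the reversed dart `α d` is never on the `σ_H`-orbit of the dart `d`. -/
theorem iterate_hullSucc_ne_swap {p : EuclideanSpace ℝ (Fin 3) × EuclideanSpace ℝ (Fin 3)} (hp : p
    ∈ hullDarts X) (k : ℕ) :
    (hullSucc X)^[k] p ≠ p.swap := fun h =>
  fst_ne_snd_of_mem_hullDarts hp (by rw [← iterate_hullSucc_fst (X := X) k p, h]; rfl)

end HullRotSys

end Summit.Ventures.Crystal3D
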